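import Literature.NumberTheory.EllipticCurves.Rank1Residual.X9MuInvariant
import Literature.NumberTheory.EllipticCurves.Rank1Residual.Typed.X10bHeegnerIndexCertificate
import Literature.NumberTheory.EllipticCurves.Rank1Residual.Typed.X9
import HarnessLib

/-!
# Class X9, rank `0`, `ord_p #Ш_an = 2`: Cha's index bound (upper half) + a native `p`-descent line (lower half) — the `μ`-FREE closure of the X9 "SHA rows", PER PAIR

HONEST FRAMING (cell `b2b-bsdres`, run/shared/lean/b2b/bsd-rank1-residual/, verbatim in every
file): the goal of the cell is to DELETE the COMBINATION-SHAPED residual classes of the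
Birch–Swinnerton-Dyer formula for ALL analytic-rank `≤ 1` elliptic curves over `ℚ` — "full BSD
formula for every rank `≤ 1` curve in class `C`" assembled STRICTLY from published theorems — so
that the rank-`≤ 1` remainder becomes exactly the CONSTRUCTION-SHAPED classes, which are TYPED
(missing-input `Prop`s), NOT attempted. This is not "finishing BSD". Unit `b2b-bsdres-x9`, gen 13.
Theorems only (compositions of tree theorems BY NAME); no definition, no named fact; class X9
(good ordinary `p ≥ 5`, `ρ̄_{E,p}` irreducible and NOT surjective) STAYS TYPED at class level
(`Typed.X9.MissingInputAt` = the integral cyclotomic main conjecture at a prime of small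
irreducible image, not in print); nothing is booked by this unit; PER PAIR.

## What this file records, and why

The X9 census (`N < 5·10⁵`, X9-CENSUS-G8…G12) has 14 rank-`0` "SHA rows" — 13 pairs `(E, 5)` with
`ord₅ #Ш(E)_an = 2` (`#Ш_an = 25`, or `100` for `464648c1`) and one pair at `p = 7` (image `7Ns`, not
touched here). Their route of record so far
(`X9/IwasawaLowerBound.lean`, gen 9) is: UPPER half from Cha 2005 (Miller 2011 Thm. 5.2, tree fact
`Cha2005.thm52_padicValNat_shaOrder_le`: IRREDUCIBILITY suffices, no surjectivity) with a Heegner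
field whose Heegner point has index of `5`-adic order EXACTLY `1` (two engines), and LOWER half
`ord₅ #Ш ≥ 2` from Burungale–Castella–Skinner 2025 Thm. 1.1.2 (a) + Greenberg's Thm. 4.1 + the
period unit + a `μ(𝓛₅(E)) = 0` certificate (`X9.bsdp_of_classX9_of_cha_of_unitCoeff`) — or, for four
of them, from VISIBILITY (gen 8).  Gen 12/13 supply a THIRD lower half that uses NO Iwasawa theory
and NO congruent curve: an EXACT `5`-DESCENT line `Sel^(5)(E/ℚ) ≠ 0` — for the two `5Ns` rows by
x11c's Shapiro descent (`351424bn1`: `dim_𝔽₅ Sel^(5) = 2`, EXACT, kit j103105; `131043s1` pending the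
engine's `S`-enlargement, this unit's kit j105889), for the eleven `5S4` rows by x11c's gen-13 full
`5`-descent over the degree-`24` field `R = ℚ(E[5]∖0)` (`s4desc`; the class group of `R` is GRH-conditional
unless a Zimmert certificate is attached; this unit's kit j105079 + verifier; dimension, certificate
status and verifier verdict PER ROW in `HOME/b2b-bsdres-x9/X9-CENSUS-G13.md`).  At rank `0` with
`5 ∤ #E(ℚ)_tors` (irreducibility) a non-zero
`5`-Selmer element IS a non-zero element of `Ш(E)[5]`, Cassels–Tate makes `#Ш` a square, so
`25 ∣ #Ш(E)`; with Cha's `ord₅ #Ш ≤ 2` the `5`-part is EXACT: `#Ш(E)[5^∞] = 25 = #Ш(E)_an`, i.e.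
Miller's `BSD(E,5)`.  This is x10b's X10 pattern (`Typed/X10bHeegnerIndexCertificate.lean`, the
class-free `Typed.bsdp_of_cha_of_casselsTate_of_selmerGroup_ne_bot`) and harvest-1's X7/X8 twins
(`Supersingular/ChaDescentRoute.lean`); this file is the X9 twin, with `irr(p)`, `¬CM` and `p ≠ 2`
DISCHARGED by the class predicate `ClassX9 W p`:

* `bsdp_rankZero_of_classX9_of_cha_of_casselsTate_of_selmerGroup_ne_bot` — `r_an = 0`,
  `ord_p #Ш_an = 2`, Heegner datum with `p ∤ d_K`, `p² ∤ N`, `ord_p [E(K) : ℤ y_K] ≤ 1`,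
  `Sel^(p)(E/ℚ) ≠ 0` ⟹ `BSDp W p`;  `padicValNat_shaOrder_eq_two_of_classX9_…`: `ord_p #Ш(E/ℚ) = 2`;
* `bsdp_of_classX9_of_cha_of_casselsTate_of_dvd` — the general exponent: `r_an ≤ 1`,
  `ord_p #Ш_an = 2k`, index `≤ k`, lower certificate `p^{2k−1} ∣ #Ш(E/ℚ)`;
* `missingInputAt_of_classX9_of_cha_of_casselsTate_of_selmerGroup_ne_bot` — the typed X9 input
  `Typed.X9.MissingInputAt W p` DISCHARGED at such a pair (bookkeeping);
* `mu_eq_zero_of_classX9_of_cha_of_casselsTate_of_selmerGroup_ne_bot` — and THEREFORE, by gen 5's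
  converse `X9.mu_eq_zero_of_bsdp` (BCS 2025 Thm. 1.1.2 (a) `hBCS`, Greenberg Thm. 4.1 `hGr`, period
  unit `h5`, modularity, GZK, plus the analytic certificate `μ(𝓛_p(E)) = 0`), Greenberg's
  `μ(X(E/ℚ_∞)) = 0` holds at the pair: the typed residue of X9 is SETTLED there, not bypassed —
  the Iwasawa-theoretic input is now a CONSEQUENCE at these pairs, not a hypothesis of `BSD(E,p)`.

Census instances (gen 13, `HOME/b2b-bsdres-x9/X9-CENSUS-G13.md`; the lane books, the referee
rules; nothing booked here): `351424bn1 @5` (index `ord₅ = 1` at `D = −127, −151`, two engines;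
descent EXACT, unconditional); the `5S4` rows `38088v1, 219024bv1, 219024bv2, 272484k1, 272484k2,
274752br1, 347328cd1, 374544bm1, 374544bm2, 464648c1` (index `ord₅ = 1` rows of gens 8–12) as far as
their descent line of kit j105079 reads `dim_𝔽₅ Sel^(5) = 2` (per row in the census file, with its GRH /
Zimmert status); `199988e1` has index `ord₅ = 2` at every field (Tamagawa `c₁₇₃ = 5`) and is NOT an
instance (its upper half is Jetchev's, flagged). Per-pair KERNEL RECORDS with every Galois / CM /
minimality hypothesis decided from the integer model: `X9/ChaDescentRecords.lean` (gen 13).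

References: B. Cha, J. Number Theory 111 (2005) 154–178 [Cha2005]; R. L. Miller, LMS J. Comput.
Math. 14 (2011), Thm. 5.2, Def. 1.1 [Miller2011LMS]; J. W. S. Cassels 1962 / J. H. Silverman, AEC
Thm. X.4.14 [SilvermanAEC2009]; G. Grigorov, A. Jorza, S. Patrikis, W. Stein, C. Tarniţă, Math.
Comp. 78 (2009), Prop. 3.35 (the same combination for `681b`) [GrigorovJorzaPatrikisSteinTarnita2009];
A. Burungale, F. Castella, C. Skinner, IMRN 2025, Thm. 1.1.2 (a) [BurungaleCastellaSkinner2025];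
R. Greenberg, LNM 1716 (1999), Thm. 4.1 and Conj. 1.11 [GreenbergLNM1716]; E. F. Schaefer,
M. Stoll, Trans. AMS 356 (2004) §3 (descent via the étale algebra of `E[p]∖0`).
-/

set_option autoImplicit false

noncomputable section

open scoped Classical MatrixGroups ModularForm

open CongruenceSubgroup WeierstrassCurve Literature.NumberTheory.EllipticCurves
  Literature.NumberTheory.EllipticCurves.ModularForms
  Literature.NumberTheory.EllipticCurves.Rank1Residual
  Literature.NumberTheory.EllipticCurves.Rank1Residual.Typed

namespace Summit.BirchSwinnertonDyer.Rank1Residual.X9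

variable (W : WeierstrassCurve ℚ) [W.IsElliptic] [W.IsGloballyMinimal] (p : ℕ) [hp : Fact p.Prime]
  {N : ℕ} [NeZero N] {K : Type} [Field K] [NumberField K]

/-- **X9 ∩ {r_an = 0}, `ord_p #Ш_an = 2`: `BSD(E,p)` from PUBLISHED theorems plus two finite
certificates, with NO Iwasawa-theoretic input.**  Granted Gross–Zagier–Kolyvagin (`hGZK`),
Cassels–Tate (`hCT`) and Cha 2005 (`hCha`, Miller Thm. 5.2 — irreducibility suffices): at an X9 pair
(`ClassX9 W p`: non-CM, good ordinary `p ≥ 5`, `E[p]` irreducible, `ρ̄` not onto) of analytic rank `0`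
with `#Ш(E)_an = q`, `ord_p q = 2`, a Heegner field `K` (imaginary quadratic, Heegner hypothesis for
the level `N`, `p ∤ d_K`, `p² ∤ N`) whose Heegner point `P = y_K` has infinite order and index
certificate `ord_p [E(K) : ℤ P] ≤ 1`, and the `p`-descent line `Sel^(p)(E/ℚ) ≠ 0`, Miller's
`BSD(E,p)` holds.  `irr(p)`, `¬CM`, `p ≠ 2` come from the class; `¬surj` is unused.  Per pair; NOT a
class theorem; the lane books the certificates.
[cite: Miller2011LMS, Thm. 5.2 and Def. 1.1] [cite: SilvermanAEC2009, Thm. X.4.14]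
[cite: GrigorovJorzaPatrikisSteinTarnita2009, Prop. 3.35] -/
theorem bsdp_rankZero_of_classX9_of_cha_of_casselsTate_of_selmerGroup_ne_bot
    (hGZK : rank_eq_analyticRank_of_analyticRank_le_one)
    (hCT : exists_casselsTate_pairing (K := ℚ)) (hCha : Cha2005.thm52_padicValNat_shaOrder_le)
    (hX9 : ClassX9 W p) (hr : W.analyticRank = 0)
    (hK : IsImaginaryQuadratic K) (hH : SatisfiesHeegnerHypothesis N K)
    {P : (W.baseChange K).toAffine.Point} (hP : IsHeegnerPoint N W K P) (hnt : ¬ IsOfFinAddOrder P)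
    (hpD : ¬ (p : ℤ) ∣ NumberField.discr K) (hpN : ¬ p ^ 2 ∣ N)
    (hI : padicValNat p (AddSubgroup.zmultiples P).index ≤ 1)
    {q : ℚ} (hq : shaAn W = (q : ℂ)) (hv : padicValRat p q = 2)
    (hSel : W.selmerGroup (p : ℤ) ≠ ⊥) : BSDp W p := by
  obtain ⟨hcm, -, hp5, hirr, -, -⟩ := id hX9
  have hp2 : p ≠ 2 := by omega
  exact Typed.bsdp_of_cha_of_casselsTate_of_selmerGroup_ne_bot W p hGZK hCT hCha hcm hr hK hH hP
    hnt hp2 hpD hpN hirr hI hq hv hSel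

/-- **The exact `p`-part on such an X9 pair: `ord_p #Ш(E/ℚ) = 2`** — the descent's non-zero class
(at rank `0`, `p ∤ #E(ℚ)_tors` by irreducibility) and Cassels–Tate squareness give `p² ∣ #Ш`, Cha's
bound with the index certificate gives `≤ 2`.  No analytic `Ш` value is needed for this statement.
[cite: Miller2011LMS, Thm. 5.2] [cite: SilvermanAEC2009, Thm. X.4.14] -/
theorem padicValNat_shaOrder_eq_two_of_classX9_of_cha_of_selmerGroup_ne_bot
    (hGZK : rank_eq_analyticRank_of_analyticRank_le_one)
    (hCT : exists_casselsTate_pairing (K := ℚ)) (hCha : Cha2005.thm52_padicValNat_shaOrder_le)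
    (hX9 : ClassX9 W p) (hr : W.analyticRank = 0)
    (hK : IsImaginaryQuadratic K) (hH : SatisfiesHeegnerHypothesis N K)
    {P : (W.baseChange K).toAffine.Point} (hP : IsHeegnerPoint N W K P) (hnt : ¬ IsOfFinAddOrder P)
    (hpD : ¬ (p : ℤ) ∣ NumberField.discr K) (hpN : ¬ p ^ 2 ∣ N)
    (hI : padicValNat p (AddSubgroup.zmultiples P).index ≤ 1)
    (hSel : W.selmerGroup (p : ℤ) ≠ ⊥) : padicValNat p W.shaOrder = 2 := by
  obtain ⟨hcm, -, hp5, hirr, -, -⟩ := id hX9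
  have hp2 : p ≠ 2 := by omega
  have hr1 : W.analyticRank ≤ 1 := by rw [hr]; norm_num
  have hrank : W.mordellWeilRank = 0 := by rw [(hGZK W hr1).1, hr]
  have htors : ¬ p ∣ W.torsionOrder := by
    intro hd
    have h0 := padicValNat_torsionOrder_eq_zero_of_irreducible W p hirr
    rw [padicValNat.eq_zero_iff] at h0
    rcases h0 with h | h | h
    · exact absurd h hp.out.one_lt.ne'
    · exact absurd h W.torsionOrder_pos_holds.ne'
    · exact h hd
  have hdvd : p ∣ W.shaOrder :=
    dvd_shaOrder_of_exists_torsion W p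
      (exists_sha_torsion_of_selmerGroup_ne_bot W p hSel hrank htors)
  simpa using Typed.padicValNat_shaOrder_eq_of_cha_of_casselsTate_of_dvd W p hGZK hCT hCha hcm hr1
    hK hH hP hnt hp2 hpD hpN hirr (k := 1) hI (by simpa using hdvd)

/-- **X9, any analytic rank `≤ 1`, general exponent**: `ord_p #Ш_an = 2k`, a Heegner datum with
index `ord_p [E(K) : ℤ y_K] ≤ k`, and a lower certificate `p^{2k−1} ∣ #Ш(E/ℚ)` ⟹ `BSD(E,p)` (for
`k = 1` at rank `0` this is the previous theorem; for `#Ш_an` of `p`-order `4` a `p`-descent alone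
gives only `k = 1`-type information and a deeper lower certificate is needed).  Class-free content:
`Typed.bsdp_of_cha_of_casselsTate_of_dvd`. [cite: Miller2011LMS, Thm. 5.2 and Def. 1.1]
[cite: SilvermanAEC2009, Thm. X.4.14] -/
theorem bsdp_of_classX9_of_cha_of_casselsTate_of_dvd
    (hGZK : rank_eq_analyticRank_of_analyticRank_le_one)
    (hCT : exists_casselsTate_pairing (K := ℚ)) (hCha : Cha2005.thm52_padicValNat_shaOrder_le)
    (hX9 : ClassX9 W p) (hr : W.analyticRank ≤ 1)
    (hK : IsImaginaryQuadratic K) (hH : SatisfiesHeegnerHypothesis N K)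
    {P : (W.baseChange K).toAffine.Point} (hP : IsHeegnerPoint N W K P) (hnt : ¬ IsOfFinAddOrder P)
    (hpD : ¬ (p : ℤ) ∣ NumberField.discr K) (hpN : ¬ p ^ 2 ∣ N)
    {k : ℕ} (hI : padicValNat p (AddSubgroup.zmultiples P).index ≤ k)
    {q : ℚ} (hq : shaAn W = (q : ℂ)) (hv : padicValRat p q = 2 * k)
    (hdvd : p ^ (2 * k - 1) ∣ W.shaOrder) : BSDp W p := by
  obtain ⟨hcm, -, hp5, hirr, -, -⟩ := id hX9
  have hp2 : p ≠ 2 := by omega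
  exact Typed.bsdp_of_cha_of_casselsTate_of_dvd W p hGZK hCT hCha hcm hr hK hH hP hnt hp2 hpD hpN
    hirr hI hq hv hdvd

/-- **X9's typed residue `Typed.X9.MissingInputAt W p` is discharged at such a pair** (rank `0`,
`ord_p #Ш_an = 2`, index `≤ 1`, descent line) — bookkeeping: the type asks for nothing more than the
`p`-part (`Typed.X9.missingInputAt_of_bsdp`). [cite: Miller2011LMS, Thm. 5.2 and Def. 1.1]
[cite: SilvermanAEC2009, Thm. X.4.14] -/
theorem missingInputAt_of_classX9_of_cha_of_casselsTate_of_selmerGroup_ne_bot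
    (hGZK : rank_eq_analyticRank_of_analyticRank_le_one)
    (hCT : exists_casselsTate_pairing (K := ℚ)) (hCha : Cha2005.thm52_padicValNat_shaOrder_le)
    (hX9 : ClassX9 W p) (hr : W.analyticRank = 0)
    (hK : IsImaginaryQuadratic K) (hH : SatisfiesHeegnerHypothesis N K)
    {P : (W.baseChange K).toAffine.Point} (hP : IsHeegnerPoint N W K P) (hnt : ¬ IsOfFinAddOrder P)
    (hpD : ¬ (p : ℤ) ∣ NumberField.discr K) (hpN : ¬ p ^ 2 ∣ N)
    (hI : padicValNat p (AddSubgroup.zmultiples P).index ≤ 1)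
    {q : ℚ} (hq : shaAn W = (q : ℂ)) (hv : padicValRat p q = 2)
    (hSel : W.selmerGroup (p : ℤ) ≠ ⊥) : Typed.X9.MissingInputAt W p := by
  have hr1 : W.analyticRank ≤ 1 := by rw [hr]; norm_num
  haveI : Finite W.sha := (hGZK W hr1).2
  exact Typed.X9.missingInputAt_of_bsdp W p
    (bsdp_rankZero_of_classX9_of_cha_of_casselsTate_of_selmerGroup_ne_bot W p hGZK hCT hCha hX9 hr
      hK hH hP hnt hpD hpN hI hq hv hSel)

/-- **…and THEREFORE Greenberg's `μ(X(E/ℚ_∞)) = 0` holds at the pair** (every cyclotomic dual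
datum), by gen 5's converse `X9.mu_eq_zero_of_bsdp`: PUBLISHED binders Burungale–Castella–Skinner
2025 Thm. 1.1.2 (a) (`hBCS`, rational cyclotomic main conjecture, NO image hypothesis), Greenberg
LNM 1716 Thm. 4.1 (`hGr`), the period unit (`h5`), modularity (`hmodP`, `hmodL`), GZK; plus the
finite analytic certificate `hcert` (one unit coefficient of `ϖ·L_p(f, α)`).  So at an X9 SHA row
closed by Cha + descent + Cassels–Tate, the Iwasawa-theoretic content of the typed residue (the
integral main conjecture's `μ`-part, Greenberg's Conj. 1.11 instance) is a CONSEQUENCE, not an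
input.  Per pair; not a class theorem. [cite: Miller2011LMS, Thm. 5.2 and Def. 1.1]
[cite: BurungaleCastellaSkinner2025, Thm. 1.1.2 (a)] [cite: GreenbergLNM1716, Conj. 1.11 and Thm. 4.1 (p. 102)] -/
theorem mu_eq_zero_of_classX9_of_cha_of_casselsTate_of_selmerGroup_ne_bot
    (hBCS : burungale_castella_skinner_charIdeal_eq_padicLFunction)
    (hGr : greenberg_charValue_rankZero) (h5 : realPeriodRat_eq_unit_mul_plusPeriod)
    (hmodP : nonempty_modularParametrizationData) (hmodL : hasEntireLFunction_rat)
    (hGZK : rank_eq_analyticRank_of_analyticRank_le_one)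
    (hCT : exists_casselsTate_pairing (K := ℚ)) (hCha : Cha2005.thm52_padicValNat_shaOrder_le)
    (hX9 : ClassX9 W p) (hr : W.analyticRank = 0)
    (hK : IsImaginaryQuadratic K) (hH : SatisfiesHeegnerHypothesis N K)
    {P : (W.baseChange K).toAffine.Point} (hP : IsHeegnerPoint N W K P) (hnt : ¬ IsOfFinAddOrder P)
    (hpD : ¬ (p : ℤ) ∣ NumberField.discr K) (hpN : ¬ p ^ 2 ∣ N)
    (hI : padicValNat p (AddSubgroup.zmultiples P).index ≤ 1)
    {q : ℚ} (hq : shaAn W = (q : ℂ)) (hv : padicValRat p q = 2)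
    (hSel : W.selmerGroup (p : ℤ) ≠ ⊥)
    (hcert : ∀ [NeZero (W.conductorNorm ℤ)] (f : CuspForm (Gamma0 (W.conductorNorm ℤ)) 2),
        IsNewformOf W f → ∀ (ϖ : ℚ), (ϖ : ℝ) * W.realPeriodRat = plusPeriod f →
      ∃ n : ℕ, ‖PowerSeries.coeff n
        (PowerSeries.C (ϖ : ℚ_[p]) * padicLFunction f (unitRoot W p : ℚ_[p]))‖ = 1) :
    ∀ (κ : ZpExtension ℚ p) (γ : Field.absoluteGaloisGroup ℚ),
        κ.IsCyclotomic → κ.IsTopGenerator γ → IsCyclotomicVariable p γ →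
      ∀ (D : W.SelmerDualData κ γ), D.mu = 0 :=
  X9.mu_eq_zero_of_bsdp W p hBCS hGr h5 hmodP hmodL hGZK hX9 hr
    (bsdp_rankZero_of_classX9_of_cha_of_casselsTate_of_selmerGroup_ne_bot W p hGZK hCT hCha hX9 hr
      hK hH hP hnt hpD hpN hI hq hv hSel) hcert

end Summit.BirchSwinnertonDyer.Rank1Residual.X9

end
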